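import Mathlib
import Literature.Computability.AlgebraicComplexity.StandardFamiliesProofs
import Summits.ValiantsHypothesis.ValiantsHypothesis.Theorems.ChowBorderDepth3ChowBorderBoundBorderFanInOne
import Summits.ValiantsHypothesis.ValiantsHypothesis.Theorems.ChowBorderDepth3ChowBorderBoundFanInTwoBounds
import Summits.ValiantsHypothesis.ValiantsHypothesis.Theorems.ChowBorderDepth3ChowBorderBoundFanInTwoChasmArith
import Summits.ValiantsHypothesis.ValiantsHypothesis.Theorems.ChowBorderDepth3ChowBorderBoundFanInRungs

/-!
# The crux `ChowBorderDepth3.ChowBorderBound` at top fan-in two: `C(⌊n/4⌋, ⌊n/8⌋) ≤ 4D`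

Sub-goal of crux `stmt-ValiantsHypothesis-5936`
(`Summit.ValiantsHypothesis.ValiantsHypothesis.Theses.ChowBorderDepth3.ChowBorderBound`), line
`registered`, lead c2 — the ASSEMBLY of wave 2.  Kumar (2020) showed that every form is a border
sum of TWO products of affine forms once the number `D` of factors is exponential; here we prove
the converse for the permanent, for ARBITRARY (non-local) two-summand border expressions:

* `choose_le_of_fanInTwo` — if `Π_j ℓ_0j + Π_j ℓ_1j = ε^q per_n + ε^(q+1) G` with affine
  `ℓ_ij` over `ℂ[ε]` (`j < D`, any `q`, `n ≥ 8`), then `C(⌊n/4⌋, ⌊n/8⌋) ≤ 4D`.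

Mechanism (exact divide–derive over `ℂ(x)((ε))`, fraction-free; Dutta–Dwivedi–Saxena 2021 for
the idea of DiDIL): normalise every factor by its ε-adic order (`BorderFanInOne`); if the two
gates do not blow up, or blow up at different orders, reduction mod `ε` writes `per_n` as a sum
of ≤ 2 products of affine forms over `ℂ`, impossible (`FanInRungs.perPoly_ne_sps_of_lt`); if they
cancel (`T₀ + T₁ = ε^(w+1) B`, `t₀ = −t₁` for the reductions), then `∂_ε log(T₀/T₁)` is a sum of
`2D` fractions `∂_ε λ/λ`, each a function of two affine forms, so every quotient-derivative
numerator `ε^w · qdn P₁ Λ u` lies in a `4D`-generated `ℂ[ε]`-module (`EpsSpan`), while its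
reduction is a non-zero multiple of `qdn per_n t₁ u` (`QuotDerivCalc`); residue transfer
(`ResidueTransfer`) bounds every ℂ-independent family of the latter by `4D`; on the other side
the torus `x_ij ↦ τ^(n i + j + 1) x_ij` degenerates `t₁` to a monomial (`DegenerationDatum`),
independence transfers from the initial form (`InitialFormTransfer`), and at a monomial
denominator `C(⌊n/4⌋, s)` independent numerators are explicit (`MonomialLowerBound`).

References: M. Kumar, ACM Trans. Comput. Theory 12 (2020), doi:10.1145/3371506 (fan-in two
suffices with exponential degree); P. Dutta, P. Dwivedi, N. Saxena, FOCS 2021 /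
SIAM J. Comput. (DiDIL); J. M. Landsberg, *Geometry and complexity theory* (2017) Cor. 7.5.3.3.
-/

-- `Summit.ValiantsHypothesis.ValiantsHypothesis.…` is the tree's mandated single-conjunct layout
-- (Sub = Summit), so the duplicated namespace component is intended.
set_option linter.dupNamespace false

namespace Summit.ValiantsHypothesis.ValiantsHypothesis.Theorems.ChowBorderBound.FanInTwo

open MvPolynomial
open Literature.Computability.AlgebraicComplexity
open Summit.ValiantsHypothesis.ValiantsHypothesis.Theorems.ChowBorderBound.QuotDeriv
open scoped Polynomial

variable {n : ℕ}

/-! ## The crux at top fan-in two: `C(⌊n/4⌋, ⌊n/8⌋) ≤ 4D` -/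

/-- **The crux at top fan-in two (quantitative form).**  If `Π_j ℓ_0j + Π_j ℓ_1j = ε^q per_n +
ε^(q+1) G` with `2D` affine forms `ℓ_ij` over `ℂ[ε]` and `n ≥ 8`, then `C(⌊n/4⌋, ⌊n/8⌋) ≤ 4D`.
In particular the padded permanent is not in `σ₂(Ch_D(ℂ^(n²+1)))` unless `D ≥ 2^(n/4)/(n+4)`:
Kumar's fan-in-two border expressions (doi:10.1145/3371506) need exponential degree for `per_n`
even when they are NOT local. [cite: DuttaDwivediSaxena2022, §3 (DiDIL)] -/
theorem choose_le_of_fanInTwo (hn : 8 ≤ n) (D q : ℕ)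
    (ℓ : Fin 2 → Fin D → MvPolynomial (Fin n × Fin n) ℂ[X])
    (G : MvPolynomial (Fin n × Fin n) ℂ[X]) (hdeg : ∀ i j, (ℓ i j).totalDegree ≤ 1)
    (hsum : (∑ i, ∏ j, ℓ i j) =
      C (Polynomial.X ^ q) * MvPolynomial.map Polynomial.C (perPoly (Fin n) ℂ) +
        C (Polynomial.X ^ (q + 1)) * G) :
    (n / 4).choose (n / 8) ≤ 4 * D := by
  classical
  have hn2 : 2 ≤ n := le_trans (by norm_num) hn
  have h1n : 1 < n := lt_of_lt_of_le (by norm_num) hn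
  have h2n : 2 < n := lt_of_lt_of_le (by norm_num) hn
  obtain ⟨s, hs⟩ : ∃ s : ℕ, s = n / 8 := ⟨_, rfl⟩
  have hs1 : 1 ≤ s := by omega
  have hs4 : 4 * s ≤ n := by omega
  -- the target is `ε^q · Btar` with `Btar ≡ per (mod ε)`
  obtain ⟨Btar, hBtar⟩ : ∃ Btar : MvPolynomial (Fin n × Fin n) ℂ[X],
      Btar = MvPolynomial.map Polynomial.C (perPoly (Fin n) ℂ) + C Polynomial.X * G := ⟨_, rfl⟩
  have htarget : C (Polynomial.X ^ q) * MvPolynomial.map Polynomial.C (perPoly (Fin n) ℂ) +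
      C (Polynomial.X ^ (q + 1)) * G = C (Polynomial.X ^ q) * Btar := by
    rw [hBtar, pow_succ, map_mul]; ring
  have hredC : (Polynomial.constantCoeff : ℂ[X] →+* ℂ).comp Polynomial.C = RingHom.id ℂ := by
    ext x; simp
  have hBred : MvPolynomial.map Polynomial.constantCoeff Btar = perPoly (Fin n) ℂ := by
    rw [hBtar, map_add, map_mul, map_C, map_map, hredC, map_id, Polynomial.constantCoeff_apply,
      Polynomial.coeff_X_zero, C_0, zero_mul, add_zero]
  -- Step 0: no factor vanishes (else the other gate alone is a fan-in-one border expression)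
  have htwo : ∀ (i : Fin 2) (f : Fin 2 → MvPolynomial (Fin n × Fin n) ℂ[X]),
      ∑ i', f i' = f i + f (i + 1) := by
    intro i f
    fin_cases i <;> simp [Fin.sum_univ_two, add_comm]
  have hℓne : ∀ i j, ℓ i j ≠ 0 := by
    intro i j h0
    have hprod : ∏ j, ℓ i j = 0 := Finset.prod_eq_zero (Finset.mem_univ j) h0
    have hsum' := hsum
    rw [htwo i (fun i' => ∏ j, ℓ i' j), hprod, zero_add] at hsum'
    exact BorderFanInOne.stub_borderFanInOne n hn2 D q (ℓ (i + 1)) G (hdeg (i + 1)) hsum'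
  -- Step 1: ε-adic normalisation of every factor
  choose e ℓ' hℓ' using fun i j => BorderFanInOne.exists_eq_C_X_pow_mul (ℓ i j) (hℓne i j)
  obtain ⟨E, hE⟩ : ∃ E : Fin 2 → ℕ, ∀ i, E i = ∑ j, e i j := ⟨_, fun _ => rfl⟩
  obtain ⟨T, hT⟩ : ∃ T : Fin 2 → MvPolynomial (Fin n × Fin n) ℂ[X], ∀ i, T i = ∏ j, ℓ' i j :=
    ⟨_, fun _ => rfl⟩
  have hgate : ∀ i, ∏ j, ℓ i j = C (Polynomial.X ^ E i) * T i := by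
    intro i
    rw [hE i, hT i, ← Finset.prod_pow_eq_pow_sum, map_prod, ← Finset.prod_mul_distrib]
    exact Finset.prod_congr rfl fun j _ => (hℓ' i j).1
  have hdeg' : ∀ i j, (MvPolynomial.map Polynomial.constantCoeff (ℓ' i j)).totalDegree ≤ 1 :=
    fun i j => (NegativeDBound.totalDegree_map_le _ _).trans ((hℓ' i j).2.2.trans (hdeg i j))
  have hred_ne : ∀ i j, MvPolynomial.map Polynomial.constantCoeff (ℓ' i j) ≠ 0 :=
    fun i j => (hℓ' i j).2.1
  have hTred : ∀ i, MvPolynomial.map Polynomial.constantCoeff (T i) =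
      ∏ j, MvPolynomial.map Polynomial.constantCoeff (ℓ' i j) := fun i => by
    rw [hT i, map_prod]
  have hTne : ∀ i, MvPolynomial.map Polynomial.constantCoeff (T i) ≠ 0 := fun i => by
    rw [hTred]; exact Finset.prod_ne_zero_iff.2 fun j _ => hred_ne i j
  -- the lower bound for the reduced gate `t₁ = Π_j red ℓ'_1j` (used in the cancelling case)
  obtain ⟨m₁, hm₁⟩ : ∃ m₁ : Fin D → MvPolynomial (Fin n × Fin n) ℂ,
      ∀ j, m₁ j = MvPolynomial.map Polynomial.constantCoeff (ℓ' 1 j) := ⟨_, fun _ => rfl⟩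
  have hdeg₁ : ∀ j, (m₁ j).totalDegree ≤ 1 := fun j => by rw [hm₁ j]; exact hdeg' 1 j
  have hne₁ : ∀ j, m₁ j ≠ 0 := fun j => by rw [hm₁ j]; exact hred_ne 1 j
  have hTm₁ : MvPolynomial.map Polynomial.constantCoeff (T 1) = ∏ j, m₁ j := by
    rw [hTred 1]; exact Finset.prod_congr rfl fun j _ => (hm₁ j).symm
  obtain ⟨Γ, hcard, hli⟩ := exists_independent_of_affine_prod hs1 hs4 m₁ hdeg₁ hne₁
  -- the normalised identity `ε^E₀ T₀ + ε^E₁ T₁ = ε^q Btar`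
  have hid : C (Polynomial.X ^ E 0) * T 0 + C (Polynomial.X ^ E 1) * T 1 =
      C (Polynomial.X ^ q) * Btar := by
    rw [← hgate 0, ← hgate 1, ← htarget, ← hsum, Fin.sum_univ_two]
  -- a classical gate is impossible: `per_n` is not a product of `D` affine forms over `ℂ`
  have hone : ∀ i, MvPolynomial.map Polynomial.constantCoeff (T i) ≠ perPoly (Fin n) ℂ := by
    intro i
    rw [hTred i]
    exact prod_ne_perPoly h1n _ (hdeg' i)
  -- Step 2: the blow-up orders
  rcases lt_trichotomy (E 0) (E 1) with h01 | h01 | h10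
  · exact absurd (red_eq_perPoly_of_lt hid h01 (hTne 0) hBred) (hone 0)
  swap
  · rw [add_comm] at hid
    exact absurd (red_eq_perPoly_of_lt hid h10 (hTne 1) hBred) (hone 1)
  -- equal orders `E₀ = E₁`: `ε^E (T₀ + T₁) = ε^q Btar`
  have hid' : C (Polynomial.X ^ E 0) * (T 0 + T 1) = C (Polynomial.X ^ q) * Btar := by
    rw [mul_add, ← hid, h01]
  by_cases hsum0 : MvPolynomial.map Polynomial.constantCoeff (T 0) +
      MvPolynomial.map Polynomial.constantCoeff (T 1) = 0
  swap
  · -- non-cancelling: `per_n = t₀ + t₁`, a classical fan-in-two expression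
    have hE0 : E 0 = q := by
      rcases lt_trichotomy (E 0) q with h | h | h
      · exact absurd (by simpa [map_add] using
          BorderFanInOne.map_constantCoeff_eq_zero_of_lt h hid') hsum0
      · exact h
      · exact absurd (hBred ▸ BorderFanInOne.map_constantCoeff_eq_zero_of_lt h hid'.symm)
          (perPoly_ne_zero (Fin n) ℂ)
    have hCq : (C (Polynomial.X ^ q) : MvPolynomial (Fin n × Fin n) ℂ[X]) ≠ 0 :=
      C_ne_zero.2 (pow_ne_zero _ Polynomial.X_ne_zero)
    rw [hE0] at hid'
    have h2 := congrArg (MvPolynomial.map Polynomial.constantCoeff) (mul_left_cancel₀ hCq hid')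
    rw [map_add, hBred] at h2
    rw [hTred 0, hTred 1] at h2
    exact (prod_add_prod_ne_perPoly h2n _ hdeg' h2).elim
  -- Step 3: the cancelling case `t₀ + t₁ = 0`: then `E₀ < q`, `T₀ + T₁ = ε^(w+1) Btar`
  have hlt : E 0 < q := by
    rcases lt_trichotomy (E 0) q with h | h | h
    · exact h
    · exfalso
      have hCq : (C (Polynomial.X ^ q) : MvPolynomial (Fin n × Fin n) ℂ[X]) ≠ 0 :=
        C_ne_zero.2 (pow_ne_zero _ Polynomial.X_ne_zero)
      rw [h] at hid'
      have h2 := congrArg (MvPolynomial.map Polynomial.constantCoeff) (mul_left_cancel₀ hCq hid')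
      rw [map_add, hsum0, hBred] at h2
      exact perPoly_ne_zero (Fin n) ℂ h2.symm
    · exact absurd (hBred ▸ BorderFanInOne.map_constantCoeff_eq_zero_of_lt h hid'.symm)
        (perPoly_ne_zero (Fin n) ℂ)
  obtain ⟨w, hw⟩ : ∃ w, q = E 0 + (w + 1) := ⟨q - E 0 - 1, by omega⟩
  have hcoreA : T 0 + T 1 = C (Polynomial.X ^ (w + 1)) * Btar := by
    have hCE : (C (Polynomial.X ^ E 0) : MvPolynomial (Fin n × Fin n) ℂ[X]) ≠ 0 :=
      C_ne_zero.2 (pow_ne_zero _ Polynomial.X_ne_zero)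
    refine mul_left_cancel₀ hCE ?_
    rw [hid', hw, pow_add, map_mul, mul_assoc]
  -- transport to `ℂ[x, ε]` (`X none = ε`)
  obtain ⟨Φ, hΦ⟩ : ∃ Φ : MvPolynomial (Fin n × Fin n) ℂ[X] →ₐ[ℂ] MvPolynomial (Option (Fin n × Fin n)) ℂ,
      Φ = MvPolynomial.aevalTower (Polynomial.aeval (MvPolynomial.X (none : Option (Fin n × Fin n))))
        (fun v : Fin n × Fin n =>
          (MvPolynomial.X (some v) : MvPolynomial (Option (Fin n × Fin n)) ℂ)) := ⟨_, rfl⟩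
  obtain ⟨lam, hlam_def⟩ : ∃ lam : Fin 2 → Fin D → MvPolynomial (Option (Fin n × Fin n)) ℂ,
      ∀ i j, lam i j = Φ (ℓ' i j) := ⟨_, fun _ _ => rfl⟩
  have hlam : ∀ i j, ∃ (a₀ : ℂ[X]) (a : Fin n × Fin n → ℂ[X]),
      lam i j = Polynomial.aeval (MvPolynomial.X (none : Option (Fin n × Fin n)) :
          MvPolynomial (Option (Fin n × Fin n)) ℂ) a₀ +
        ∑ v : Fin n × Fin n, Polynomial.aeval (MvPolynomial.X (none : Option (Fin n × Fin n)) :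
          MvPolynomial (Option (Fin n × Fin n)) ℂ) (a v) * MvPolynomial.X (some v) :=
    fun i j => by rw [hlam_def, hΦ]; exact aevalTower_affine ((hℓ' i j).2.2.trans (hdeg i j))
  have hΦT : ∀ i, Φ (T i) = ∏ j, lam i j := fun i => by
    rw [hT i, map_prod]; exact Finset.prod_congr rfl fun j _ => (hlam_def i j).symm
  have hcore : (∏ j, lam 0 j) + (∏ j, lam 1 j) =
      (MvPolynomial.X (none : Option (Fin n × Fin n)) : MvPolynomial (Option (Fin n × Fin n)) ℂ) ^
        (w + 1) * Φ Btar := by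
    rw [← hΦT 0, ← hΦT 1, ← map_add, hcoreA, map_mul, hΦ, aevalTower_C', map_pow,
      Polynomial.aeval_X]
  have hB : MvPolynomial.aeval (fun o : Option (Fin n × Fin n) =>
      o.elim (0 : MvPolynomial (Fin n × Fin n) ℂ) X) (Φ Btar) = perPoly (Fin n) ℂ := by
    rw [hΦ, red_aevalTower, hBred]
  have hredT : ∀ i, MvPolynomial.aeval (fun o : Option (Fin n × Fin n) =>
      o.elim (0 : MvPolynomial (Fin n × Fin n) ℂ) X) (∏ j, lam i j) =
        MvPolynomial.map Polynomial.constantCoeff (T i) := fun i => by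
    rw [← hΦT, hΦ, red_aevalTower]
  have ht : MvPolynomial.aeval (fun o : Option (Fin n × Fin n) =>
        o.elim (0 : MvPolynomial (Fin n × Fin n) ℂ) X) (∏ j, lam 0 j) =
      - MvPolynomial.aeval (fun o : Option (Fin n × Fin n) =>
        o.elim (0 : MvPolynomial (Fin n × Fin n) ℂ) X) (∏ j, lam 1 j) := by
    rw [hredT 0, hredT 1]
    exact eq_neg_of_add_eq_zero_left hsum0
  have ht1 : MvPolynomial.aeval (fun o : Option (Fin n × Fin n) =>
      o.elim (0 : MvPolynomial (Fin n × Fin n) ℂ) X) (∏ j, lam 1 j) ≠ 0 := by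
    rw [hredT 1]; exact hTne 1
  -- Step 4: the upper bound for the independent family of Step 1
  have hli' : LinearIndependent ℂ (fun u : Γ => quotDerivNum (perPoly (Fin n) ℂ)
      (MvPolynomial.aeval (fun o : Option (Fin n × Fin n) =>
        o.elim (0 : MvPolynomial (Fin n × Fin n) ℂ) X) (∏ j, lam 1 j))
      (List.ofFn fun k => u.1 k)) := by
    rw [hredT 1, hTm₁]
    exact hli
  subst hs
  exact hcard.trans (card_le_of_cancelling lam (Φ Btar) hlam hcore hB ht ht1 (n / 8) Γ hli')

end Summit.ValiantsHypothesis.ValiantsHypothesis.Theorems.ChowBorderBound.FanInTwo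

namespace Summit.ValiantsHypothesis.ValiantsHypothesis.Theorems.ChowBorderBound.FanInTwo

/-- **Rung (border, top fan-in `r = 2`) of crux `ChowBorderDepth3.ChowBorderBound`**, registered
form: a two-summand border Chow expression of the padded permanent with `D` factors per summand
forces `C(⌊n/4⌋, ⌊n/8⌋) ≤ 4D` (`n ≥ 8`, every `q`).  Since `C(⌊n/4⌋, ⌊n/8⌋) ≥ 2^⌊n/4⌋/(⌊n/4⌋+1)`,
the crux holds at `r = 2` for every `D < 2^(n/4)/(n+4)`, far beyond the chasm range.
[cite: DuttaDwivediSaxena2022, §3 (DiDIL)] -/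
theorem chowBorderBound_fanInTwo_choose :
    ∀ (n : ℕ), 8 ≤ n → ∀ (D q : ℕ)
      (ℓ : Fin 2 → Fin D → MvPolynomial (Fin n × Fin n) (Polynomial ℂ))
      (G : MvPolynomial (Fin n × Fin n) (Polynomial ℂ)), (∀ i j, (ℓ i j).totalDegree ≤ 1) →
      (∑ i, ∏ j, ℓ i j) = MvPolynomial.C (Polynomial.X ^ q) *
          MvPolynomial.map Polynomial.C
            (Literature.Computability.AlgebraicComplexity.perPoly (Fin n) ℂ) +
        MvPolynomial.C (Polynomial.X ^ (q + 1)) * G →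
      (n / 4).choose (n / 8) ≤ 4 * D :=
  fun _ hn D q ℓ G hdeg hsum => choose_le_of_fanInTwo hn D q ℓ G hdeg hsum

/-- **Rung (border, top fan-in `r ≤ 2`) of crux `ChowBorderDepth3.ChowBorderBound`** — the crux
VERBATIM with its bound `r ≤ (n+2)^(c⌊√n⌋+c)` on the top fan-in replaced by `r ≤ 2` (and the
bound on `D` kept): for every `c`, all large `n`, all `r ≤ 2` and all `D ≤ (n+2)^(c⌊√n⌋+c)`, the
padded permanent has no border expression `Σ_{i<r} Π_{j<D} ℓ_ij = ε^q per_n + ε^(q+1) G`.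
(`r ≤ 1`: `FanInRungs.chowBorderBound_fanInLeOne`, no bound on `D` needed; `r = 2`:
`C(⌊n/4⌋, ⌊n/8⌋) ≤ 4D` against `4 (n+2)^(c⌊√n⌋+c) < C(⌊n/4⌋, ⌊n/8⌋)` eventually.)
[cite: DuttaDwivediSaxena2022, §3 (DiDIL)] -/
theorem chowBorderBound_fanInLeTwo :
    ∀ c : ℕ, ∃ n₀ : ℕ, ∀ n ≥ n₀, ∀ r D : ℕ, r ≤ 2 → D ≤ (n + 2) ^ (c * Nat.sqrt n + c) →
    ¬ ∃ (q : ℕ) (ℓ : Fin r → Fin D → MvPolynomial (Fin n × Fin n) (Polynomial ℂ))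
        (G : MvPolynomial (Fin n × Fin n) (Polynomial ℂ)),
        (∀ i j, (ℓ i j).totalDegree ≤ 1) ∧
        (∑ i, ∏ j, ℓ i j) = MvPolynomial.C (Polynomial.X ^ q) *
            MvPolynomial.map Polynomial.C
              (Literature.Computability.AlgebraicComplexity.perPoly (Fin n) ℂ) +
          MvPolynomial.C (Polynomial.X ^ (q + 1)) * G := by
  intro c
  obtain ⟨n₀, hn₀⟩ := FanInTwoChasmArith.stub_fanInTwoChasmArith c
  refine ⟨n₀, fun n hn r D hr hD hex => ?_⟩
  obtain ⟨h8, harith⟩ := hn₀ n hn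
  rcases Nat.lt_or_ge r 2 with hr1 | hr2
  · exact FanInRungs.chowBorderBound_fanInLeOne n (by omega) r D (by omega) hex
  · obtain rfl : r = 2 := le_antisymm hr hr2
    obtain ⟨q, ℓ, G, hdeg, hsum⟩ := hex
    have hch := choose_le_of_fanInTwo h8 D q ℓ G hdeg hsum
    have h4 : 4 * D ≤ 4 * (n + 2) ^ (c * Nat.sqrt n + c) := Nat.mul_le_mul_left 4 hD
    omega

end Summit.ValiantsHypothesis.ValiantsHypothesis.Theorems.ChowBorderBound.FanInTwo
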